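import Summits.QuantumFields.BalabanUV.T4Continuum.Support.LineAveragingTwoLevelPairing
import Summits.QuantumFields.BalabanUV.T4Continuum.Support.DirichletSubregionTowerOf

/-!
# T⁴ programme, spine node NE2 (U1a), sub-row Δ1 «NE2⁰-Dirichlet» — THE TWO-LEVEL COMMUTATOR OF THE MASS TERM `a·n^d·Q_nᴴQ_n` WITH
# KING's PLANTING ON THE TORUS, `‖J_L·(a n^d Q_nᴴQ_n) − (a (Ln)^d Q_{Ln}ᴴQ_{Ln})·J_L‖ ≤ 3a·n⁻¹`, and the LAYER LEMMA for (1.18)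

NE2 formalisation swarm `b2b-balaban-t4-ne2-formalise-*`, LEAF PROVER 07 (gen 8), owner item O14-b′ «W3-BOX-COMPRESSED», piece
**(P-mass)** «W3-MASS-PAIRING» (journal 2026-08-20 l.20983 / l.21413; owner rulings R33/R34), file 3 of 4 — the two TORUS inputs of the
region file `RegionMassTwoLevel`:

 * §0 generic vector lemmas (rectangular `toBlock` on vectors, `nsq` of a restriction, `√nsq(Xv) ≤ ‖X‖√nsq v`);
 * §1 THE LAYER LEMMA **`nsq_QvOp_mulVec_le_of_layer`**: a bond field vanishing off the top `w` `ν`-layers of the unit blocks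
   (`h(z,ν) = 0` whenever `digit_ν z + w < n`) is averaged down by (1.18) by the layer's relative thickness,
   `‖Q_n h‖² ≤ (w/n)·n^{−d}·‖h‖²` (each contour meets the layer in `≤ w` bonds: `card_filter_digit_le`, `norm_lineSum_sq_le_of_layer`) — the
   region file applies it at the fine level `Ln_k` with `w = L` to the planted children of DEFICIENT star bonds (the source of the honest
   `n_k^{−1/2}` of the truncation term);
 * §2 **`opNorm_JK_massComm_le`**: from the two planted pairing identities (`LineAveragingPairing.sqrt_smul_QvOp_mul_JK` and
   `LineAveragingTwoLevelPairing.opNorm_QvOp_mul_Qavg_sub_le`) the leading terms `a n^d√(L^d)·Q_{Ln}ᴴQ_n` of `J_L·(a n^d Q_nᴴQ_n)` and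
   `(a (Ln)^d Q_{Ln}ᴴQ_{Ln})·J_L` CANCEL EXACTLY, leaving `ρ·D_Eᴴ Q_n − ρ c_L·Q_{Ln}ᴴ·Q_n(S₁ − 1)` (`ρ = a n^d √(L^d)`), of operator norm
   `≤ 2a/n + a/n = 3a·n⁻¹` by file 1's `opNorm_QvOp_mul_shiftT_sub_one_le` (no regularity of any field).

HONEST FRAMING (T4-DAG p. 1).  `U = 1`; finite torus; Bałaban's line-sum averaging (1.18) and King's block averaging /
planting (2.10) as the tree types them; exact lattice identities and Cauchy–Schwarz only — no Fourier analysis, no regularity of any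
field; statements, pairings and constants OURS ([folklore]; the `[cite:]` tags locate the printed OBJECTS, Bałaban and King print no
such two-level identity); ONE summand (the mass term) of ONE displayed binder (W3, King's compressed injected law) of the cell's NE2 crux
is served; W3 on boxes OPEN; Δ1 NOT closed; NE2 (U1a) NOT proved; spine PROVED 0/9 unchanged; NOT [B9] (3.16)/(3.23)–(3.27) as printed;
NOT infinite volume, NOT a mass gap, NOT the Clay problem, NOT summit progress.  HONEST DEPENDENCY: continuum YM on T⁴ ⇐ BetaPertH ∧ nine
spine estimates (0/9 proved); BetaPertH ⇐ (D1) ∧ (D4) ∧ CAP+tail; G-an2-4 gates asym, D1 and NE2/3/4.  No `sorry`.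
-/

noncomputable section

open scoped BigOperators ComplexConjugate Matrix Matrix.Norms.L2Operator
open Finset

namespace Summit.QuantumFields.BalabanUV.T4Continuum.LineAveragingMassCommutator

open Literature.MathematicalPhysics.QuantumFieldTheory.Balaban1983to89.B5Prop11Plancherel (Tor fine unitVec)
open Literature.MathematicalPhysics.QuantumFieldTheory.Balaban1983to89.B5Prop11Lower (nsq nsq_nonneg)
open Literature.MathematicalPhysics.QuantumFieldTheory.Balaban1983to89.B5Block118 (bpt tstep tstep_zero tstep_succ lineSum
  QvOp QvOp_mulVec bpt_add_tstep)
open Literature.MathematicalPhysics.QuantumFieldTheory.Balaban1983to89.B5Blocks16 (blockOf bpt_val bpt_bijective)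
open Literature.MathematicalPhysics.QuantumFieldTheory.Balaban1983to89.B5Composition116 (tstep_add)
open Literature.MathematicalPhysics.QuantumFieldTheory.Balaban1983to89.B5G183RateTorus (cpt)
open Literature.MathematicalPhysics.QuantumFieldTheory.Balaban1983to89.B5G183RateTorusW (off Qavg Qavg_mul_apply)
open Summit.QuantumFields.BalabanUV.T4Continuum
open Summit.QuantumFields.BalabanUV.T4Continuum.BalabanAveragedTowerModes (val_cpt_add_off)
open Summit.QuantumFields.BalabanUV.T4Continuum.BalabanLineAverage (shiftT)
open Summit.QuantumFields.BalabanUV.T4Continuum.KingPairingPlantedLaw (JK opNorm_JK_le sqrt_facts)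
open Summit.QuantumFields.BalabanUV.T4Continuum.LineAveragingPairing (glue glue_val sum_glue shiftT_mulVec lineSum_shiftT_sub cL
  cL_eq norm_cL_le sqrt_smul_QvOp_mul_JK sum_range_shift)
open Summit.QuantumFields.BalabanUV.T4Continuum.ScalarMassTower (cpt_add_unitVec)
open Summit.QuantumFields.BalabanUV.T4Continuum.ScalarBlockTrialFunction (digits digits_bpt)
open Summit.QuantumFields.BalabanUV.T4Continuum.BalabanBlockPoincare (tileEquiv nsq_mulVec_le_rect)
open Summit.QuantumFields.BalabanUV.T4Continuum.CovariantBlockAveraging (opNorm_le_of_sq_le' opNorm_QvOp_le)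
open Summit.QuantumFields.BalabanUV.T4Continuum.LineAveragingTwoLevel
open Summit.QuantumFields.BalabanUV.T4Continuum.LineAveragingTwoLevelPairing (opNorm_QvOp_mul_Qavg_sub_le)
open Summit.QuantumFields.BalabanUV.T4Continuum.SubtypeCompression (sel ext toBlock_eq_sel opNorm_sel_le)
open Summit.QuantumFields.BalabanUV.T4Continuum.DirichletSubregionTowerOf (sel_conjTranspose_mulVec)

variable {d : ℕ}

/-! ## §0 Generic vector lemmas: rectangular compressions, restriction, the `√nsq` triangle inequality -/


section Generic

variable {m m' : Type*} [Fintype m] [DecidableEq m] [Fintype m'] [DecidableEq m']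

/-- a rectangular compression acts by: extend by zero, apply, restrict. [folklore] -/
theorem toBlock_mulVec_rect (X : Matrix m' m ℂ) (p' : m' → Prop) [DecidablePred p'] (p : m → Prop) [DecidablePred p]
    (w : {a // p a} → ℂ) : X.toBlock p' p *ᵥ w = sel p' *ᵥ (X *ᵥ ext p w) := by
  rw [toBlock_eq_sel, ← Matrix.mulVec_mulVec, ← Matrix.mulVec_mulVec, sel_conjTranspose_mulVec]

/-- restriction does not increase `nsq`. [folklore] -/
theorem nsq_sel_mulVec_le (p' : m' → Prop) [DecidablePred p'] (v : m' → ℂ) : nsq (sel p' *ᵥ v) ≤ nsq v :=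
  (nsq_mulVec_le_rect _ v).trans (by
    have h := opNorm_sel_le p'
    have : ‖sel p'‖ ^ 2 ≤ 1 := by nlinarith [norm_nonneg (sel p')]
    nlinarith [nsq_nonneg v])

end Generic

section Rect

/-- `√nsq (X v) ≤ ‖X‖·√nsq v` for a rectangular matrix. [folklore] -/
theorem sqrt_nsq_mulVec_le_rect {m m' : Type*} [Fintype m] [DecidableEq m] [Fintype m'] [DecidableEq m'] (X : Matrix m' m ℂ)
    (v : m → ℂ) : Real.sqrt (nsq (X *ᵥ v)) ≤ ‖X‖ * Real.sqrt (nsq v) := by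
  calc Real.sqrt (nsq (X *ᵥ v)) ≤ Real.sqrt (‖X‖ ^ 2 * nsq v) := Real.sqrt_le_sqrt (nsq_mulVec_le_rect X v)
    _ = ‖X‖ * Real.sqrt (nsq v) := by rw [Real.sqrt_mul (sq_nonneg _), Real.sqrt_sq (norm_nonneg _)]

end Rect

/-! ## §1 The layer lemma: fields supported on a thin `ν`-layer are averaged down by the layer's relative thickness -/

section Layer

variable (n : ℕ) [NeZero n] (M : Fin d → ℕ) [hM : ∀ μ, NeZero (M μ)]

/-- along a straight contour of `n` bonds in direction `ν`, at most `w` of them have `ν`-digit `≥ n − w`. [folklore] -/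
theorem card_filter_digit_le (x : Tor (fine n M)) (ν : Fin d) (w : ℕ) :
    (univ.filter fun t : Fin n => n ≤ (digits n M (x + tstep (fine n M) ν t) ν : ℕ) + w).card ≤ w := by
  set B := univ.filter fun t : Fin n => n ≤ (digits n M (x + tstep (fine n M) ν t) ν : ℕ) + w with hB
  -- the map `t ↦ digit_ν(x + t e_ν) + w − n` is injective on `B` with values in `[0, w)`
  have hmaps : ∀ t ∈ B, (digits n M (x + tstep (fine n M) ν t) ν : ℕ) + w - n ∈ range w := by
    intro t ht
    rw [hB, mem_filter] at ht
    have hlt := (digits n M (x + tstep (fine n M) ν t) ν).isLt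
    rw [mem_range]
    omega
  have hinj : Set.InjOn (fun t : Fin n => (digits n M (x + tstep (fine n M) ν t) ν : ℕ) + w - n) ↑B := by
    intro t ht t' ht' h
    rw [Finset.mem_coe, hB, mem_filter] at ht ht'
    have h2 : (digits n M (x + tstep (fine n M) ν t) ν : ℕ) = (digits n M (x + tstep (fine n M) ν t') ν : ℕ) := by
      have := ht.2; have := ht'.2; simp only at h; omega
    rw [digits_add_tstep, digits_add_tstep] at h2
    -- `(c + t) % n = (c + t') % n` with `t, t' < n` forces `t = t'`
    apply Fin.ext
    have h3 := Nat.ModEq.add_left_cancel' ((digits n M x ν : ℕ)) h2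
    unfold Nat.ModEq at h3
    rwa [Nat.mod_eq_of_lt t.isLt, Nat.mod_eq_of_lt t'.isLt] at h3
  calc B.card ≤ (range w).card := card_le_card_of_injOn _ hmaps hinj
    _ = w := card_range w

/-- a contour sum of a field vanishing off the top `w` `ν`-layers has at most `w` non-zero terms:
`‖Σ_{t<n} h(x + t e_ν, ν)‖² ≤ w · Σ_{t<n} ‖h(x + t e_ν, ν)‖²`. [folklore] -/
theorem norm_lineSum_sq_le_of_layer (w : ℕ) (h : Tor (fine n M) × Fin d → ℂ)
    (hh : ∀ (z : Tor (fine n M)) (ν : Fin d), (digits n M z ν : ℕ) + w < n → h (z, ν) = 0)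
    (x : Tor (fine n M)) (ν : Fin d) :
    ‖lineSum n M h x ν‖ ^ 2 ≤ w * ∑ t : Fin n, ‖h (x + tstep (fine n M) ν t, ν)‖ ^ 2 := by
  set B := univ.filter fun t : Fin n => n ≤ (digits n M (x + tstep (fine n M) ν t) ν : ℕ) + w with hB
  have hzero : ∀ t : Fin n, t ∉ B → h (x + tstep (fine n M) ν t, ν) = 0 := by
    intro t ht
    rw [hB, mem_filter, not_and] at ht
    exact hh _ _ (by have := ht (mem_univ t); omega)
  have hsum : lineSum n M h x ν = ∑ t ∈ B, h (x + tstep (fine n M) ν t, ν) := by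
    rw [lineSum]
    exact (sum_subset (subset_univ B) fun t _ ht => hzero t ht).symm
  rw [hsum]
  calc ‖∑ t ∈ B, h (x + tstep (fine n M) ν t, ν)‖ ^ 2
      ≤ B.card * ∑ t ∈ B, ‖h (x + tstep (fine n M) ν t, ν)‖ ^ 2 :=
        (pow_le_pow_left₀ (norm_nonneg _) (norm_sum_le _ _) 2).trans sq_sum_le_card_mul_sum_sq
    _ ≤ w * ∑ t : Fin n, ‖h (x + tstep (fine n M) ν t, ν)‖ ^ 2 := by
        refine mul_le_mul ?_ (sum_le_sum_of_subset_of_nonneg (subset_univ B) fun _ _ _ => by positivity)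
          (sum_nonneg fun _ _ => by positivity) (Nat.cast_nonneg w)
        exact_mod_cast card_filter_digit_le n M x ν w

/-- **THE LAYER LEMMA**: a field vanishing off the top `w` `ν`-layers of the blocks (`h(z,ν) = 0` unless `digit_ν z ≥ n − w`) is
averaged down by (1.18) by the relative thickness of the layer: `‖Q_n h‖² ≤ (w/n)·n^{−d}·‖h‖²`. [folklore] -/
theorem nsq_QvOp_mulVec_le_of_layer (w : ℕ) (h : Tor (fine n M) × Fin d → ℂ)
    (hh : ∀ (z : Tor (fine n M)) (ν : Fin d), (digits n M z ν : ℕ) + w < n → h (z, ν) = 0) :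
    nsq (QvOp n M *ᵥ h) ≤ (w : ℝ) * ((n : ℝ))⁻¹ * ((n : ℝ) ^ d)⁻¹ * nsq h := by
  have hn : (0 : ℝ) < n := by exact_mod_cast Nat.pos_of_ne_zero (NeZero.ne n)
  have hnd : (0 : ℝ) < (n : ℝ) ^ d := pow_pos hn d
  have hc : ‖(1 / (n : ℂ) ^ (d + 1))‖ = ((n : ℝ) ^ (d + 1))⁻¹ := by
    rw [norm_div, norm_one, norm_pow, Complex.norm_natCast, one_div]
  unfold nsq
  rw [Fintype.sum_prod_type]
  simp only [QvOp_mulVec]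
  have hterm : ∀ (y : Tor M) (ν : Fin d),
      ‖1 / (n : ℂ) ^ (d + 1) * ∑ j : Fin d → Fin n, lineSum n M h (bpt n M y j) ν‖ ^ 2
        ≤ (((n : ℝ) ^ (d + 1))⁻¹) ^ 2 * ((n : ℝ) ^ d * (w *
            ∑ j : Fin d → Fin n, ∑ t : Fin n, ‖h (bpt n M y j + tstep (fine n M) ν t, ν)‖ ^ 2)) := by
    intro y ν
    rw [norm_mul, mul_pow, hc]
    refine mul_le_mul_of_nonneg_left ?_ (sq_nonneg _)
    have h1 : ‖∑ j : Fin d → Fin n, lineSum n M h (bpt n M y j) ν‖ ^ 2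
        ≤ (univ : Finset (Fin d → Fin n)).card * ∑ j : Fin d → Fin n, ‖lineSum n M h (bpt n M y j) ν‖ ^ 2 :=
      (pow_le_pow_left₀ (norm_nonneg _) (norm_sum_le _ _) 2).trans sq_sum_le_card_mul_sum_sq
    simp only [card_univ, Fintype.card_fun, Fintype.card_fin] at h1
    push_cast at h1
    refine h1.trans ?_
    have h0 : (0 : ℝ) ≤ (n : ℝ) ^ d := by positivity
    refine mul_le_mul_of_nonneg_left ?_ h0
    rw [mul_sum]
    exact sum_le_sum fun j _ => norm_lineSum_sq_le_of_layer n M w h hh _ ν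
  refine (sum_le_sum fun y _ => sum_le_sum fun ν _ => hterm y ν).trans ?_
  have hSA : ∑ y : Tor M, ∑ ν : Fin d, ∑ j : Fin d → Fin n, ∑ t : Fin n, ‖h (bpt n M y j + tstep (fine n M) ν t, ν)‖ ^ 2
      = n * ∑ i, ‖h i‖ ^ 2 := by
    calc ∑ y : Tor M, ∑ ν : Fin d, ∑ j : Fin d → Fin n, ∑ t : Fin n, ‖h (bpt n M y j + tstep (fine n M) ν t, ν)‖ ^ 2
        = ∑ ν : Fin d, ∑ y : Tor M, ∑ j : Fin d → Fin n, ∑ t : Fin n, ‖h (bpt n M y j + tstep (fine n M) ν t, ν)‖ ^ 2 :=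
          sum_comm
      _ = ∑ ν : Fin d, ∑ t : Fin n, ∑ y : Tor M, ∑ j : Fin d → Fin n, ‖h (bpt n M y j + tstep (fine n M) ν t, ν)‖ ^ 2 := by
          refine sum_congr rfl fun ν _ => ?_
          have hin : ∀ y : Tor M, ∑ j : Fin d → Fin n, ∑ t : Fin n, ‖h (bpt n M y j + tstep (fine n M) ν t, ν)‖ ^ 2
              = ∑ t : Fin n, ∑ j : Fin d → Fin n, ‖h (bpt n M y j + tstep (fine n M) ν t, ν)‖ ^ 2 := fun y => sum_comm
          simp_rw [hin]
          exact sum_comm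
      _ = ∑ ν : Fin d, ∑ _t : Fin n, ∑ z : Tor (fine n M), ‖h (z, ν)‖ ^ 2 := by
          refine sum_congr rfl fun ν _ => sum_congr rfl fun t _ => ?_
          rw [← sum_blocks' n M (fun z => ‖h (z + tstep (fine n M) ν t, ν)‖ ^ 2)]
          exact sum_add_const n M (fun z => ‖h (z, ν)‖ ^ 2) (tstep (fine n M) ν t)
      _ = ∑ ν : Fin d, (n : ℝ) * ∑ z : Tor (fine n M), ‖h (z, ν)‖ ^ 2 := by
          refine sum_congr rfl fun ν _ => ?_
          rw [sum_const, card_univ, Fintype.card_fin, nsmul_eq_mul]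
      _ = (n : ℝ) * ∑ z : Tor (fine n M), ∑ ν : Fin d, ‖h (z, ν)‖ ^ 2 := by rw [← mul_sum, sum_comm]
      _ = n * ∑ i, ‖h i‖ ^ 2 := by rw [Fintype.sum_prod_type]
  have htot : ∑ y : Tor M, ∑ ν : Fin d, (((n : ℝ) ^ (d + 1))⁻¹) ^ 2 * ((n : ℝ) ^ d * (w *
            ∑ j : Fin d → Fin n, ∑ t : Fin n, ‖h (bpt n M y j + tstep (fine n M) ν t, ν)‖ ^ 2))
      = (((n : ℝ) ^ (d + 1))⁻¹) ^ 2 * ((n : ℝ) ^ d * (w * (n * ∑ i, ‖h i‖ ^ 2))) := by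
    simp_rw [← mul_sum]
    rw [hSA]
  rw [htot]
  have hn0 : (n : ℝ) ≠ 0 := hn.ne'
  apply le_of_eq
  field_simp
  ring

end Layer

section TwoLevel

variable (n L : ℕ) [NeZero n] [NeZero L] (M : Fin d → ℕ) [hM : ∀ μ, NeZero (M μ)]

/-! ## §2 The two-level commutator of the mass term `a·n^d·QᴴQ` with King's planting, on the torus -/

/-- **THE TORUS MASS COMMUTATOR**: `‖J_L·(a n^d·Q_nᴴQ_n) − (a (Ln)^d·Q_{Ln}ᴴQ_{Ln})·J_L‖ ≤ 3a·n⁻¹` — from the two planted pairing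
identities (`sqrt_smul_QvOp_mul_JK`: `√(L^d)·Q_{Ln}J_L = Q_n(1 + c_L(S₁−1))`, and `opNorm_QvOp_mul_Qavg_sub_le`: `Q_nQavg_L = Q_{Ln} + D_E`)
the leading terms `a n^d √(L^d)·Q_{Ln}ᴴQ_n` CANCEL EXACTLY, leaving `ρ·D_Eᴴ Q_n − ρ c_L·Q_{Ln}ᴴ Q_n(S₁ − 1)`, `ρ = a n^d √(L^d)`, each of
operator norm `≤ (3/2)·a·n⁻¹`... in total `≤ 3a/n`.  No regularity, no Fourier analysis.  [cite: Balaban1984PropagatorsI, (1.18) p.20;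
King1986, (2.10) p.653 (shapes)] [folklore] -/
theorem opNorm_JK_massComm_le (a : ℝ) (ha : 0 ≤ a) :
    ‖JK n L M * ((((a * (n : ℝ) ^ d : ℝ)) : ℂ) • ((QvOp n M)ᴴ * QvOp n M))
        - ((((a * ((L * n : ℕ) : ℝ) ^ d : ℝ)) : ℂ) • ((QvOp (L * n) M)ᴴ * QvOp (L * n) M)) * JK n L M‖
      ≤ 3 * a * ((n : ℝ))⁻¹ := by
  have hn : (0 : ℝ) < n := by exact_mod_cast Nat.pos_of_ne_zero (NeZero.ne n)
  have hL : (0 : ℝ) < L := by exact_mod_cast Nat.pos_of_ne_zero (NeZero.ne L)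
  have hnd : (0 : ℝ) < (n : ℝ) ^ d := pow_pos hn d
  have hLd : (0 : ℝ) < (L : ℝ) ^ d := pow_pos hL d
  have hsL : 0 < Real.sqrt ((L : ℝ) ^ d) := Real.sqrt_pos.mpr hLd
  obtain ⟨hstar, hss⟩ := sqrt_facts (d := d) L
  set s : ℂ := (((Real.sqrt ((L : ℝ) ^ d)) : ℝ) : ℂ) with hs
  have hs0 : s ≠ 0 := by rw [hs]; exact_mod_cast hsL.ne'
  set Q := QvOp n M with hQ
  set Q' := QvOp (L * n) M with hQ'
  set J := JK n L M with hJ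
  set D := Q * Qavg n L M - Q' with hD
  set T := Q * (shiftT (fine n M) 1 - 1) with hT
  set κ : ℂ := (((a * (n : ℝ) ^ d : ℝ)) : ℂ) with hκ
  set κ' : ℂ := (((a * ((L * n : ℕ) : ℝ) ^ d : ℝ)) : ℂ) with hκ'
  -- the two pairing identities
  have hJH : Jᴴ = s • Qavg n L M := by
    rw [hJ, JK, Matrix.conjTranspose_smul, Matrix.conjTranspose_conjTranspose, hstar]
  have h1 : J * Qᴴ = s • (Q'ᴴ + Dᴴ) := by
    have e : J * Qᴴ = (Q * Jᴴ)ᴴ := by rw [Matrix.conjTranspose_mul, Matrix.conjTranspose_conjTranspose]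
    rw [e, hJH, Matrix.mul_smul, Matrix.conjTranspose_smul, hstar, ← Matrix.conjTranspose_add]
    congr 2
    rw [hD]; abel
  have h2 : Q' * J = s⁻¹ • (Q + cL L • T) := by
    have e : s • (Q' * J) = Q + cL L • T := by
      rw [hQ', hJ, hs, sqrt_smul_QvOp_mul_JK, Matrix.mul_add, Matrix.mul_one, Matrix.mul_smul]
    rw [← e, smul_smul, inv_mul_cancel₀ hs0, one_smul]
  -- the scalar bookkeeping `κ·s = κ′·s⁻¹ =: ρ`
  have hρ : κ' * s⁻¹ = κ * s := by
    rw [mul_inv_eq_iff_eq_mul₀ hs0, mul_assoc, hss, hκ, hκ']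
    push_cast; ring
  -- THE CANCELLATION
  have hX : J * (κ • (Qᴴ * Q)) - (κ' • (Q'ᴴ * Q')) * J = (κ * s) • (Dᴴ * Q) - (κ * s * cL L) • (Q'ᴴ * T) := by
    rw [Matrix.mul_smul, Matrix.smul_mul, ← Matrix.mul_assoc, h1, Matrix.mul_assoc Q'ᴴ, h2, Matrix.smul_mul, Matrix.mul_smul,
      smul_smul, smul_smul, hρ, Matrix.add_mul, Matrix.mul_add, Matrix.mul_smul, smul_add, smul_add, smul_smul]
    abel
  rw [hX]
  -- norms of the pieces
  have hq : ‖Q‖ ≤ (Real.sqrt ((n : ℝ) ^ d))⁻¹ := opNorm_QvOp_le n M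
  have hq' : ‖Q'ᴴ‖ ≤ (Real.sqrt (((L * n : ℕ) : ℝ) ^ d))⁻¹ := by rw [Matrix.l2_opNorm_conjTranspose]; exact opNorm_QvOp_le (L * n) M
  have hDn : ‖Dᴴ‖ ≤ 2 * ((n : ℝ))⁻¹ * (Real.sqrt (((L * n : ℕ) : ℝ) ^ d))⁻¹ := by
    rw [Matrix.l2_opNorm_conjTranspose]; exact opNorm_QvOp_mul_Qavg_sub_le n L M
  have hTn : ‖T‖ ≤ 2 * ((n : ℝ))⁻¹ * (Real.sqrt ((n : ℝ) ^ d))⁻¹ := opNorm_QvOp_mul_shiftT_sub_one_le n M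
  have hcL : ‖cL L‖ ≤ 1 / 2 := norm_cL_le L (Nat.pos_of_ne_zero (NeZero.ne L))
  have hκs : ‖κ * s‖ = a * (n : ℝ) ^ d * Real.sqrt ((L : ℝ) ^ d) := by
    rw [norm_mul, hκ, hs, Complex.norm_real, Complex.norm_real, Real.norm_of_nonneg (by positivity), Real.norm_of_nonneg hsL.le]
  have hsqLn : Real.sqrt (((L * n : ℕ) : ℝ) ^ d) = Real.sqrt ((L : ℝ) ^ d) * Real.sqrt ((n : ℝ) ^ d) := by
    rw [← Real.sqrt_mul hLd.le]; push_cast; rw [mul_pow]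
  have hq0 : 0 ≤ (Real.sqrt ((n : ℝ) ^ d))⁻¹ := inv_nonneg.mpr (Real.sqrt_nonneg _)
  have hq0' : 0 ≤ (Real.sqrt (((L * n : ℕ) : ℝ) ^ d))⁻¹ := inv_nonneg.mpr (Real.sqrt_nonneg _)
  calc ‖(κ * s) • (Dᴴ * Q) - (κ * s * cL L) • (Q'ᴴ * T)‖
      ≤ ‖(κ * s) • (Dᴴ * Q)‖ + ‖(κ * s * cL L) • (Q'ᴴ * T)‖ := norm_sub_le _ _
    _ ≤ ‖κ * s‖ * (‖Dᴴ‖ * ‖Q‖) + ‖κ * s‖ * ‖cL L‖ * (‖Q'ᴴ‖ * ‖T‖) := by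
        rw [norm_smul, norm_smul, norm_mul (κ * s)]
        exact add_le_add (mul_le_mul_of_nonneg_left (Matrix.l2_opNorm_mul _ _) (norm_nonneg _))
          (mul_le_mul_of_nonneg_left (Matrix.l2_opNorm_mul _ _) (by positivity))
    _ ≤ (a * (n : ℝ) ^ d * Real.sqrt ((L : ℝ) ^ d)) * ((2 * ((n : ℝ))⁻¹ * (Real.sqrt (((L * n : ℕ) : ℝ) ^ d))⁻¹) * (Real.sqrt ((n : ℝ) ^ d))⁻¹)
        + (a * (n : ℝ) ^ d * Real.sqrt ((L : ℝ) ^ d)) * (1 / 2) *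
          ((Real.sqrt (((L * n : ℕ) : ℝ) ^ d))⁻¹ * (2 * ((n : ℝ))⁻¹ * (Real.sqrt ((n : ℝ) ^ d))⁻¹)) := by
        rw [hκs]
        have hA : 0 ≤ a * (n : ℝ) ^ d * Real.sqrt ((L : ℝ) ^ d) := by positivity
        refine add_le_add ?_ ?_
        · exact mul_le_mul_of_nonneg_left (mul_le_mul hDn hq (norm_nonneg _) (by positivity)) hA
        · exact mul_le_mul (mul_le_mul_of_nonneg_left hcL hA) (mul_le_mul hq' hTn (norm_nonneg _) hq0') (by positivity)
            (by positivity)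
    _ = 3 * a * ((n : ℝ))⁻¹ := by
        rw [hsqLn]
        set sN := Real.sqrt ((n : ℝ) ^ d) with hsN
        set sL := Real.sqrt ((L : ℝ) ^ d) with hsL'
        have h1' : sN ≠ 0 := (Real.sqrt_pos.mpr hnd).ne'
        have h2' : sL ≠ 0 := hsL.ne'
        have h3' : (n : ℝ) ≠ 0 := hn.ne'
        have h4' : sN * sN = (n : ℝ) ^ d := Real.mul_self_sqrt hnd.le
        have hAq : a * (n : ℝ) ^ d * sL * (sN⁻¹ * (sL * sN)⁻¹) = a := by
          rw [← h4']; field_simp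
        calc a * (n : ℝ) ^ d * sL * (2 * ((n : ℝ))⁻¹ * (sL * sN)⁻¹ * sN⁻¹) + a * (n : ℝ) ^ d * sL * (1 / 2) * ((sL * sN)⁻¹ * (2 * ((n : ℝ))⁻¹ * sN⁻¹))
            = 3 * (a * (n : ℝ) ^ d * sL * (sN⁻¹ * (sL * sN)⁻¹)) * ((n : ℝ))⁻¹ := by ring
          _ = 3 * a * ((n : ℝ))⁻¹ := by rw [hAq]

end TwoLevel

end Summit.QuantumFields.BalabanUV.T4Continuum.LineAveragingMassCommutator

end
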